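import Summits.AnomalousDissipation.AnomalousDissipation.Theorems.SawtoothPulseCascadeK1LocalisedCascadeFibreChirp
import Summits.AnomalousDissipation.AnomalousDissipation.Theorems.SawtoothPulseCascadeK1LocalisedCascadeKoopmanLeakage

/-!
# K1loc, line `Spectral` / thin start — helper: THE INCOMPLETE-SHIFT WINDOW LEMMA ON THE FIBRES OF A SHEAR (S-D step)

Helper file of the prover lane on the crux `K1LocalisedCascade` (stmt-AnomalousDissipation-19491), route
`SawtoothPulseCascade` (S-D lane: uniform-in-`n` channel bounds for the explicit inviscid iterates, target of record
`K1Ledger.From.k1Localised_of_thin_lowBand_offCone` / `…_released_energy`).  Continuation of `…FibreChirp`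
(`mFourierCoeff_comp_shearMap_eq_chirp`: on the slab `kᵢ = n` the Koopman operator of the shear `Φ(x) = x − φ(x_j)eᵢ`
is multiplication of the fibre component `A^i_n θ` by the chirp `g_n(x_j) = e_{−n}(φ(x_j))`).

THE WINDOW LEMMA (`sum_window_sq_norm_comp_shearMap_le`, abstract form; the analytic heart of a spectral ledger for the
inviscid iterates).  Data: a finite WINDOW `W` of output modes, a splitting `θ = θ₁ + θ₂` of the input (`θ₁` = the part
whose fully shifted image misses the window, `θ₂` = the rest), and for every fibre `n` met by `W` a splitting of the
chirp `g_n = g^mid_n + g^rest_n` into continuous circle functions such that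
* (SEPARATION, exact) `ĝ^rest_n(m) · 𝓕θ₁(k − m eⱼ) = 0` for all `k ∈ W` on the fibre and all shifts `m` — the `rest`
  part of the chirp cannot move a mode of `θ₁` into the window;
* (MID-BAND BOUND, pointwise) `‖g^mid_n(b)‖ ≤ ρ(b)` for one continuous `ρ ≥ 0` on the circle (in the application: `ρ ≈`
  the indicator of the corner zones, by non-stationary phase off the flats of the rounded sawtooth).
Conclusion:  `Σ_{k ∈ W} ‖𝓕((θ₁ + θ₂) ∘ Φ)(k)‖² ≤ ( √(∫ ρ(x_j)² ‖θ₁(x)‖² dx) + √(∫ ‖θ₂(x)‖² dx) )²`.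
The first term is paid in PHYSICAL space (after summing over fibres it is an integral of `‖θ₁‖²` against the zone weight
`ρ(x_j)²`, bounded by `sup ρ² · ‖θ₁‖_∞² · |zones|` for a bounded scalar — the sup norm of the inviscid iterates is `1`),
the second is the energy of the input part that may legitimately land in the window; the coefficient of `√(∫‖θ₂‖²)` is
EXACTLY one (no `1 + ‖ρ‖_∞`), which is what makes the ledger's recursion telescope.
Ingredients: `mFourierCoeff_mul_comp_eval` (coefficients of `G(x_j)·f(x)` = convolution along `eⱼ` with the circle
coefficients of `G`; the fibre formula of `TorusShearKoopman` for an arbitrary continuous multiplier), the chirp reduction,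
Parseval (`hasSum_sq_mFourierCoeff_of_continuous`, `hasSum_integral_twistedAxisAvg_sq`) and finite Minkowski.
No definitions; no statement about the crux. [cite: Grafakos2014, Prop. 3.1.2 (5) and Prop. 3.2.7 (3)] [problem: turb]
-/

-- `Summit.<Summit>.<Problem>`: single-conjunct summit, the duplicate namespace segment is deliberate.
set_option linter.dupNamespace false

noncomputable section

namespace Summit.AnomalousDissipation.AnomalousDissipation.Theorems.SawtoothPulseCascade.K1Window

open MeasureTheory Set Filter Topology UnitAddTorus Function
open scoped ENNReal
open Literature.Analysis.FunctionSpaces Literature.Analysis.FunctionSpaces.Torus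
open Summit.AnomalousDissipation.AnomalousDissipation.Theorems.SawtoothPulseCascade.K1Start

variable {d : Type*} [Fintype d] [DecidableEq d]

/-! ## §1 Coefficients of the product with a function of one coordinate -/

/-- **Product with a function of the coordinate `x_j` = convolution along `eⱼ`.**  For a continuous circle function `G`
and a continuous `f : T^d → ℂ` with absolutely summable Fourier coefficients,
`𝓕(x ↦ G(x_j)·f(x))(k) = ∑_{m ∈ ℤ} Ĝ(m)·𝓕f(k − m eⱼ)` (expand `f` in its absolutely convergent Fourier series, integrate term
by term, `Torus.mFourierCoeff_comp_eval`). [cite: Grafakos2014, Prop. 3.1.2 (5)] -/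
theorem mFourierCoeff_mul_comp_eval {G : UnitAddCircle → ℂ} (hG : Continuous G) {f : UnitAddTorus d → ℂ}
    (hf : Continuous f) (hfs : Summable fun k => ‖mFourierCoeff f k‖) (j : d) (k : d → ℤ) :
    mFourierCoeff (fun x => G (x j) * f x) k = ∑' m : ℤ, fourierCoeff G m * mFourierCoeff f (k - Pi.single j m) := by
  classical
  set φ : C(UnitAddTorus d, ℂ) := ⟨f, hf⟩ with hφ_def
  have hφf : (φ : UnitAddTorus d → ℂ) = f := rfl
  have hs : Summable (mFourierCoeff (φ : UnitAddTorus d → ℂ)) := .of_norm hfs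
  obtain ⟨B, hB⟩ := isCompact_univ.exists_bound_of_continuousOn hG.continuousOn
  have hB0 : 0 ≤ B := (norm_nonneg _).trans (hB 0 (mem_univ _))
  -- the terms of the expanded integrand
  set S : (d → ℤ) → UnitAddTorus d → ℂ := fun k' x =>
    mFourier (-k) x * (G (x j) * (mFourierCoeff f k' * mFourier k' x)) with hS_def
  have hpt : ∀ x, HasSum (fun k' => S k' x) (mFourier (-k) x * (G (x j) * f x)) := by
    intro x
    have h := ((hasSum_mFourier_series_apply_of_summable hs x).mul_left (G (x j))).mul_left (mFourier (-k) x)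
    refine h.congr_fun fun k' => ?_
    simp only [hS_def, hφf, smul_eq_mul]
  have hSm : ∀ k', AEStronglyMeasurable (S k') volume := fun k' =>
    (((mFourier (-k)).continuous).mul ((hG.comp (continuous_apply j)).mul
      (continuous_const.mul (mFourier k').continuous))).aestronglyMeasurable
  have hSnorm : ∀ k' x, ‖S k' x‖ ≤ B * ‖mFourierCoeff f k'‖ := by
    intro k' x
    simp only [hS_def, norm_mul, norm_mFourier_apply (-k), norm_mFourier_apply k', one_mul, mul_one]
    exact mul_le_mul_of_nonneg_right (hB _ (mem_univ _)) (norm_nonneg _)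
  have hSlint : ∀ k', ∫⁻ x, ‖S k' x‖ₑ ∂(volume : Measure (UnitAddTorus d)) ≤ ENNReal.ofReal (B * ‖mFourierCoeff f k'‖) := by
    intro k'
    calc ∫⁻ x, ‖S k' x‖ₑ ∂(volume : Measure (UnitAddTorus d))
        ≤ ∫⁻ _x, ENNReal.ofReal (B * ‖mFourierCoeff f k'‖) ∂(volume : Measure (UnitAddTorus d)) := by
          refine lintegral_mono fun x => ?_
          rw [← ofReal_norm]
          exact ENNReal.ofReal_le_ofReal (hSnorm k' x)
      _ = ENNReal.ofReal (B * ‖mFourierCoeff f k'‖) := by rw [lintegral_const, measure_univ, mul_one]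
  have hStop : ∑' k', ∫⁻ x, ‖S k' x‖ₑ ∂(volume : Measure (UnitAddTorus d)) ≠ ⊤ := by
    refine ne_top_of_le_ne_top ?_ (ENNReal.tsum_le_tsum hSlint)
    rw [← ENNReal.ofReal_tsum_of_nonneg (fun k' => by positivity) (hfs.mul_left B)]
    exact ENNReal.ofReal_ne_top
  -- integrate term by term
  have hint : mFourierCoeff (fun x => G (x j) * f x) k = ∑' k', ∫ x, S k' x := by
    rw [mFourierCoeff_eq_integral_volume]
    simp_rw [smul_eq_mul]
    rw [← integral_tsum hSm hStop]
    exact integral_congr_ae (Eventually.of_forall fun x => ((hpt x).tsum_eq).symm)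
  -- each term
  have hterm : ∀ k', ∫ x, S k' x =
      if ∀ l, l ≠ j → k' l = k l then fourierCoeff G (k j - k' j) * mFourierCoeff f k' else 0 := by
    intro k'
    have e1 : ∀ x, S k' x = mFourierCoeff f k' * (mFourier (-(k - k')) x • G (x j)) := by
      intro x
      simp only [hS_def, smul_eq_mul]
      have : mFourier (-(k - k')) x = mFourier (-k) x * mFourier k' x := by
        rw [show -(k - k') = -k + k' by abel, mFourier_add]
      rw [this]; ring
    simp_rw [e1]
    rw [integral_const_mul, ← mFourierCoeff_eq_integral_volume, mFourierCoeff_comp_eval hG j (k - k')]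
    by_cases h : ∀ l, l ≠ j → k' l = k l
    · have h' : ∀ l, l ≠ j → (k - k') l = 0 := fun l hl => by simp [h l hl]
      rw [if_pos h', if_pos h, Pi.sub_apply, mul_comm]
    · have h' : ¬ ∀ l, l ≠ j → (k - k') l = 0 := by
        intro h''
        exact h fun l hl => by have := h'' l hl; rw [Pi.sub_apply, sub_eq_zero] at this; exact this.symm
      rw [if_neg h', if_neg h, mul_zero]
  rw [hint]
  simp_rw [hterm]
  -- reindex the fibre by `m ↦ k - m eⱼ`
  have hinj : Function.Injective fun m : ℤ => k - Pi.single j m := by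
    intro m m' h
    have := congrFun h j
    simpa using this
  rw [← hinj.tsum_eq]
  · refine tsum_congr fun m => ?_
    have hm : ∀ l, l ≠ j → (k - Pi.single j m : d → ℤ) l = k l := fun l hl => by
      simp [Pi.single_eq_of_ne hl]
    rw [if_pos hm]
    simp
  · intro k' hk'
    rw [Function.mem_support] at hk'
    by_cases h : ∀ l, l ≠ j → k' l = k l
    · refine ⟨k j - k' j, ?_⟩
      funext l
      by_cases hl : l = j
      · subst hl; simp
      · simp [Pi.single_eq_of_ne hl, h l hl]
    · exact absurd (if_neg h) hk'


/-! ## §2 Small facts: additivity of circle coefficients, the fibre component of a product -/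

omit [Fintype d] [DecidableEq d] in
/-- Circle Fourier coefficients are additive on continuous functions. [cite: Grafakos2014, Prop. 3.1.2 (5)] -/
theorem fourierCoeff_add_of_continuous {G H : UnitAddCircle → ℂ} (hG : Continuous G) (hH : Continuous H) (m : ℤ) :
    fourierCoeff (fun b => G b + H b) m = fourierCoeff G m + fourierCoeff H m := by
  have hc : Continuous fun t : UnitAddCircle => (fourier (-m) t : ℂ) := (fourier (-m)).continuous
  have hGi : Integrable (fun t => (fourier (-m) t : ℂ) • G t) AddCircle.haarAddCircle :=
    integrableOn_univ.mp ((hc.smul hG).continuousOn.integrableOn_compact isCompact_univ)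
  have hHi : Integrable (fun t => (fourier (-m) t : ℂ) • H t) AddCircle.haarAddCircle :=
    integrableOn_univ.mp ((hc.smul hH).continuousOn.integrableOn_compact isCompact_univ)
  simp only [fourierCoeff, smul_add]
  exact integral_add hGi hHi

omit [Fintype d] in
/-- A factor depending on `x_j` only passes through the fibre component along `eᵢ` (`i ≠ j`):
`A^i_n(R(x_j)·f)(x) = R(x_j)·A^i_n f(x)`. [cite: Grafakos2014, Prop. 3.1.2 (5)] -/
theorem twistedAxisAvg_mul_comp_eval (R : UnitAddCircle → ℂ) (f : UnitAddTorus d → ℂ) {i j : d} (hij : i ≠ j) (n : ℤ)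
    (x : UnitAddTorus d) :
    ∫ s : UnitAddCircle, (fourier (-n) s : ℂ) • (R ((x + Pi.single i s : UnitAddTorus d) j) * f (x + Pi.single i s)) =
      R (x j) * ∫ s : UnitAddCircle, (fourier (-n) s : ℂ) • f (x + Pi.single i s) := by
  have hj : ∀ s : UnitAddCircle, (x + Pi.single i s : UnitAddTorus d) j = x j := fun s => by
    rw [Pi.add_apply, Pi.single_eq_of_ne (Ne.symm hij), add_zero]
  simp_rw [hj, smul_eq_mul]
  rw [← integral_const_mul]
  refine integral_congr_ae (Eventually.of_forall fun s => ?_)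
  ring

/-- The fibre component of a continuous function with absolutely summable coefficients has absolutely summable
coefficients (they are the slab `kᵢ = n` of the coefficients). [cite: Grafakos2014, Prop. 3.1.2 (5)] -/
theorem summable_norm_mFourierCoeff_twistedAxisAvg {f : UnitAddTorus d → ℂ} (hf : Continuous f)
    (hfs : Summable fun k => ‖mFourierCoeff f k‖) (i : d) (n : ℤ) :
    Summable fun k : d → ℤ =>
      ‖mFourierCoeff (fun x => ∫ s : UnitAddCircle, (fourier (-n) s : ℂ) • f (x + Pi.single i s)) k‖ := by
  refine Summable.of_nonneg_of_le (fun k => norm_nonneg _) (fun k => ?_) hfs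
  rw [mFourierCoeff_twistedAxisAvg hf i n k]
  split_ifs
  · exact le_rfl
  · rw [norm_zero]; exact norm_nonneg _

/-! ## §3 The window lemma -/

/-- **On a window mode the `rest` part of the chirp does not contribute**: for `k ∈ W` (fibre `n = kᵢ`),
`𝓕(θ₁ ∘ Φ)(k) = 𝓕(g^mid_n(x_j) · A^i_n θ₁)(k)`, by the chirp reduction, the convolution formula along `eⱼ` for the two
multipliers `g_n = g^mid_n + g^rest_n` and the exact separation `ĝ^rest_n(m)·𝓕θ₁(k − m eⱼ) = 0`.
[cite: Grafakos2014, Prop. 3.1.2 (5)] -/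
theorem mFourierCoeff_comp_shearMap_eq_mid {θ₁ : UnitAddTorus d → ℂ} (hθ₁ : Continuous θ₁)
    (hθ₁s : Summable fun k => ‖mFourierCoeff θ₁ k‖) {i j : d} (hij : i ≠ j) (P : ShearProfile)
    {gmid grest : UnitAddCircle → ℂ} (hgmid : Continuous gmid) (hgrest : Continuous grest) (k : d → ℤ)
    (hsplit : ∀ b, twist P (k i) b = gmid b + grest b)
    (hsep : ∀ m : ℤ, fourierCoeff grest m * mFourierCoeff θ₁ (k - Pi.single j m) = 0) :
    mFourierCoeff (θ₁ ∘ shearMap i j P) k =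
      mFourierCoeff (fun x => gmid (x j) * ∫ s : UnitAddCircle, (fourier (-(k i)) s : ℂ) • θ₁ (x + Pi.single i s)) k := by
  have hA : Continuous fun x : UnitAddTorus d => ∫ s : UnitAddCircle, (fourier (-(k i)) s : ℂ) • θ₁ (x + Pi.single i s) :=
    continuous_twistedAxisAvg hθ₁ i (k i)
  have hAs := summable_norm_mFourierCoeff_twistedAxisAvg hθ₁ hθ₁s i (k i)
  rw [mFourierCoeff_comp_shearMap_eq_chirp hθ₁ hij P k]
  have hfun : (fun x : UnitAddTorus d => twist P (k i) (x j) *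
        ∫ s : UnitAddCircle, (fourier (-(k i)) s : ℂ) • θ₁ (x + Pi.single i s)) =
      fun x => (fun b => gmid b + grest b) (x j) * ∫ s : UnitAddCircle, (fourier (-(k i)) s : ℂ) • θ₁ (x + Pi.single i s) := by
    funext x; rw [hsplit]
  have hGH : Continuous fun b => gmid b + grest b := hgmid.add hgrest
  rw [hfun, mFourierCoeff_mul_comp_eval (G := fun b => gmid b + grest b) hGH hA hAs j k,
    mFourierCoeff_mul_comp_eval hgmid hA hAs j k]
  refine tsum_congr fun m => ?_
  rw [fourierCoeff_add_of_continuous hgmid hgrest m, add_mul]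
  -- the `rest` term vanishes: the fibre component has the coefficients of `θ₁` on the slab
  have hz : fourierCoeff grest m *
      mFourierCoeff (fun x => ∫ s : UnitAddCircle, (fourier (-(k i)) s : ℂ) • θ₁ (x + Pi.single i s)) (k - Pi.single j m) = 0 := by
    have hcoefA := mFourierCoeff_twistedAxisAvg hθ₁ i (k i) (k - Pi.single j m)
    rw [hcoefA]
    split_ifs
    · exact hsep m
    · rw [mul_zero]
  rw [hz, add_zero]

omit [DecidableEq d] in
/-- The squared coefficients of a continuous function on any finite set of modes are at most its `L²` energy (Bessel).
[cite: Grafakos2014, Prop. 3.2.7 (3)] -/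
theorem sum_sq_norm_mFourierCoeff_le_integral {g : UnitAddTorus d → ℂ} (hg : Continuous g) (W : Finset (d → ℤ)) :
    ∑ k ∈ W, ‖mFourierCoeff g k‖ ^ 2 ≤ ∫ x : UnitAddTorus d, ‖g x‖ ^ 2 :=
  sum_le_hasSum W (fun _ _ => sq_nonneg _) (hasSum_sq_mFourierCoeff_of_continuous hg)

/-- **THE WINDOW LEMMA (incomplete-shift energy on the fibres of a shear).**  Let `Φ(x) = x − φ(x_j)eᵢ` (`i ≠ j`), `W` a
finite set of output modes, `θ₁` continuous with absolutely summable coefficients, `θ₂` continuous.  Suppose that on every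
fibre `n = kᵢ` met by `W` the chirp `g_n = e_{−n} ∘ φ` splits as `g^mid_n + g^rest_n` (continuous) with
(i) EXACT SEPARATION `ĝ^rest_n(m) · 𝓕θ₁(k − m eⱼ) = 0` for `k ∈ W` on the fibre and every `m`, and
(ii) the POINTWISE MID-BAND BOUND `‖g^mid_n(b)‖ ≤ ρ(b)` with one continuous `ρ ≥ 0`.  Then
`Σ_{k ∈ W} ‖𝓕((θ₁ + θ₂) ∘ Φ)(k)‖² ≤ (√(∫ ρ(x_j)²‖θ₁‖²) + √(∫‖θ₂‖²))²`.
(Per fibre: the window coefficients of `θ₁ ∘ Φ` are those of `g^mid_n(x_j)·A^i_nθ₁` — Bessel — `∫|g^mid_n(x_j)|²‖A^i_nθ₁‖²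
≤ ∫‖A^i_n(ρ(x_j)θ₁)‖²`; those of `θ₂ ∘ Φ` are those of `g_n(x_j)·A^i_nθ₂`, `|g_n| = 1`; the fibre sums are `∫ρ(x_j)²‖θ₁‖²` and
`∫‖θ₂‖²` by Parseval across fibres; Minkowski.) [cite: Grafakos2014, Prop. 3.1.2 (5) and Prop. 3.2.7 (3)] -/
theorem sum_window_sq_norm_comp_shearMap_le {θ₁ θ₂ : UnitAddTorus d → ℂ} (hθ₁ : Continuous θ₁)
    (hθ₁s : Summable fun k => ‖mFourierCoeff θ₁ k‖) (hθ₂ : Continuous θ₂) {i j : d} (hij : i ≠ j) (P : ShearProfile)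
    (W : Finset (d → ℤ)) (gmid grest : ℤ → UnitAddCircle → ℂ) (hgmid : ∀ n, Continuous (gmid n))
    (hgrest : ∀ n, Continuous (grest n)) (hsplit : ∀ k ∈ W, ∀ b, twist P (k i) b = gmid (k i) b + grest (k i) b)
    (hsep : ∀ k ∈ W, ∀ m : ℤ, fourierCoeff (grest (k i)) m * mFourierCoeff θ₁ (k - Pi.single j m) = 0)
    {ρ : UnitAddCircle → ℝ} (hρ : Continuous ρ) (hρ0 : ∀ b, 0 ≤ ρ b) (hbd : ∀ k ∈ W, ∀ b, ‖gmid (k i) b‖ ≤ ρ b) :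
    ∑ k ∈ W, ‖mFourierCoeff ((fun x => θ₁ x + θ₂ x) ∘ shearMap i j P) k‖ ^ 2 ≤
      (Real.sqrt (∫ x : UnitAddTorus d, ρ (x j) ^ 2 * ‖θ₁ x‖ ^ 2) +
        Real.sqrt (∫ x : UnitAddTorus d, ‖θ₂ x‖ ^ 2)) ^ 2 := by
  classical
  -- notation: fibre components and the two per-fibre products
  set A₁ : ℤ → UnitAddTorus d → ℂ := fun n x => ∫ s : UnitAddCircle, (fourier (-n) s : ℂ) • θ₁ (x + Pi.single i s) with hA₁
  set A₂ : ℤ → UnitAddTorus d → ℂ := fun n x => ∫ s : UnitAddCircle, (fourier (-n) s : ℂ) • θ₂ (x + Pi.single i s) with hA₂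
  set H₁ : ℤ → UnitAddTorus d → ℂ := fun n x => gmid n (x j) * A₁ n x with hH₁
  set H₂ : ℤ → UnitAddTorus d → ℂ := fun n x => twist P n (x j) * A₂ n x with hH₂
  have hA₁c : ∀ n, Continuous (A₁ n) := fun n => continuous_twistedAxisAvg hθ₁ i n
  have hA₂c : ∀ n, Continuous (A₂ n) := fun n => continuous_twistedAxisAvg hθ₂ i n
  have hH₁c : ∀ n, Continuous (H₁ n) := fun n => ((hgmid n).comp (continuous_apply j)).mul (hA₁c n)
  have hH₂c : ∀ n, Continuous (H₂ n) := fun n => ((continuous_twist P n).comp (continuous_apply j)).mul (hA₂c n)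
  -- Step 1: the window coefficients, mode by mode
  have hcoef : ∀ k ∈ W, mFourierCoeff ((fun x => θ₁ x + θ₂ x) ∘ shearMap i j P) k =
      mFourierCoeff (H₁ (k i)) k + mFourierCoeff (H₂ (k i)) k := by
    intro k hk
    have hsum : ((fun x => θ₁ x + θ₂ x) ∘ shearMap i j P) = (θ₁ ∘ shearMap i j P) + (θ₂ ∘ shearMap i j P) := by
      funext x; rfl
    rw [hsum, Torus.mFourierCoeff_add (F := ℂ) ((hθ₁.comp (continuous_shearMap i j P)).integrable_unitAddTorus)
      ((hθ₂.comp (continuous_shearMap i j P)).integrable_unitAddTorus),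
      mFourierCoeff_comp_shearMap_eq_mid hθ₁ hθ₁s hij P (hgmid (k i)) (hgrest (k i)) k (hsplit k hk) (hsep k hk),
      mFourierCoeff_comp_shearMap_eq_chirp hθ₂ hij P k]
  -- Step 2: Minkowski on the window
  have hMink : ∑ k ∈ W, ‖mFourierCoeff ((fun x => θ₁ x + θ₂ x) ∘ shearMap i j P) k‖ ^ 2 ≤
      (Real.sqrt (∑ k ∈ W, ‖mFourierCoeff (H₁ (k i)) k‖ ^ 2) +
        Real.sqrt (∑ k ∈ W, ‖mFourierCoeff (H₂ (k i)) k‖ ^ 2)) ^ 2 := by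
    have h1 : ∑ k ∈ W, ‖mFourierCoeff ((fun x => θ₁ x + θ₂ x) ∘ shearMap i j P) k‖ ^ 2 ≤
        ∑ k ∈ W, (‖mFourierCoeff (H₁ (k i)) k‖ + ‖mFourierCoeff (H₂ (k i)) k‖) ^ 2 := by
      refine Finset.sum_le_sum fun k hk => ?_
      rw [hcoef k hk]
      exact pow_le_pow_left₀ (norm_nonneg _) (norm_add_le _ _) 2
    have h2 := SpectralLeakage.sqrt_sum_add_sq_le W (a := fun k => ‖mFourierCoeff (H₁ (k i)) k‖)
      (b := fun k => ‖mFourierCoeff (H₂ (k i)) k‖) (fun k _ => norm_nonneg _) (fun k _ => norm_nonneg _)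
    have h0 : 0 ≤ ∑ k ∈ W, (‖mFourierCoeff (H₁ (k i)) k‖ + ‖mFourierCoeff (H₂ (k i)) k‖) ^ 2 :=
      Finset.sum_nonneg fun k _ => sq_nonneg _
    calc ∑ k ∈ W, ‖mFourierCoeff ((fun x => θ₁ x + θ₂ x) ∘ shearMap i j P) k‖ ^ 2
        ≤ ∑ k ∈ W, (‖mFourierCoeff (H₁ (k i)) k‖ + ‖mFourierCoeff (H₂ (k i)) k‖) ^ 2 := h1
      _ = (Real.sqrt (∑ k ∈ W, (‖mFourierCoeff (H₁ (k i)) k‖ + ‖mFourierCoeff (H₂ (k i)) k‖) ^ 2)) ^ 2 :=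
          (Real.sq_sqrt h0).symm
      _ ≤ _ := pow_le_pow_left₀ (Real.sqrt_nonneg _) h2 2
  -- Step 3: group the window by fibres and apply Bessel on each fibre
  set F : Finset ℤ := W.image fun k => k i with hF
  have hmaps : ∀ k ∈ W, k i ∈ F := fun k hk => Finset.mem_image_of_mem _ hk
  have hfib : ∀ (H : ℤ → UnitAddTorus d → ℂ), (∀ n, Continuous (H n)) →
      ∑ k ∈ W, ‖mFourierCoeff (H (k i)) k‖ ^ 2 ≤ ∑ n ∈ F, ∫ x : UnitAddTorus d, ‖H n x‖ ^ 2 := by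
    intro H hH
    rw [← Finset.sum_fiberwise_of_maps_to hmaps]
    refine Finset.sum_le_sum fun n hn => ?_
    calc ∑ k ∈ W with k i = n, ‖mFourierCoeff (H (k i)) k‖ ^ 2
        = ∑ k ∈ W with k i = n, ‖mFourierCoeff (H n) k‖ ^ 2 :=
          Finset.sum_congr rfl fun k hk => by rw [(Finset.mem_filter.mp hk).2]
      _ ≤ ∫ x : UnitAddTorus d, ‖H n x‖ ^ 2 := sum_sq_norm_mFourierCoeff_le_integral (hH n) _
  -- Step 4: the fibre sums.  (a) `θ₂`: `|g_n| = 1`, Parseval across fibres.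
  have hB : ∑ k ∈ W, ‖mFourierCoeff (H₂ (k i)) k‖ ^ 2 ≤ ∫ x : UnitAddTorus d, ‖θ₂ x‖ ^ 2 := by
    refine (hfib H₂ hH₂c).trans ?_
    have heq : ∀ n, ∫ x : UnitAddTorus d, ‖H₂ n x‖ ^ 2 = ∫ x : UnitAddTorus d, ‖A₂ n x‖ ^ 2 := fun n =>
      integral_congr_ae (Eventually.of_forall fun x => by
        simp only [hH₂, norm_mul, norm_twist, one_mul])
    simp_rw [heq]
    exact sum_le_hasSum F (fun n _ => integral_nonneg fun x => sq_nonneg _) (hasSum_integral_twistedAxisAvg_sq hθ₂ i)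
  -- (b) `θ₁`: `|g^mid_n| ≤ ρ`, `ρ(x_j) A^i_n θ₁ = A^i_n (ρ(x_j) θ₁)`, Parseval across fibres for `ρ(x_j)θ₁`.
  have hA : ∑ k ∈ W, ‖mFourierCoeff (H₁ (k i)) k‖ ^ 2 ≤ ∫ x : UnitAddTorus d, ρ (x j) ^ 2 * ‖θ₁ x‖ ^ 2 := by
    -- the window only meets fibres on which the bound `‖gmid n‖ ≤ ρ` is available
    have hbdF : ∀ n ∈ F, ∀ b, ‖gmid n b‖ ≤ ρ b := by
      intro n hn b
      obtain ⟨k, hk, rfl⟩ := Finset.mem_image.mp hn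
      exact hbd k hk b
    refine (hfib H₁ hH₁c).trans ?_
    set v : UnitAddTorus d → ℂ := fun x => ((ρ (x j) : ℝ) : ℂ) * θ₁ x with hv
    have hvc : Continuous v := (Complex.continuous_ofReal.comp (hρ.comp (continuous_apply j))).mul hθ₁
    set Av : ℤ → UnitAddTorus d → ℂ := fun n x => ∫ s : UnitAddCircle, (fourier (-n) s : ℂ) • v (x + Pi.single i s) with hAv
    have hAv_eq : ∀ n x, Av n x = ((ρ (x j) : ℝ) : ℂ) * A₁ n x := fun n x =>
      twistedAxisAvg_mul_comp_eval (fun b => ((ρ b : ℝ) : ℂ)) θ₁ hij n x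
    have hle : ∀ n ∈ F, ∫ x : UnitAddTorus d, ‖H₁ n x‖ ^ 2 ≤ ∫ x : UnitAddTorus d, ‖Av n x‖ ^ 2 := by
      intro n hn
      refine integral_mono_of_nonneg (Eventually.of_forall fun x => sq_nonneg _)
        (((continuous_norm.comp (continuous_twistedAxisAvg hvc i n)).pow 2).integrable_unitAddTorus)
        (Eventually.of_forall fun x => ?_)
      simp only [hH₁, hAv_eq, norm_mul, Complex.norm_real, Real.norm_eq_abs, abs_of_nonneg (hρ0 _)]
      exact pow_le_pow_left₀ (by positivity) (mul_le_mul_of_nonneg_right (hbdF n hn _) (norm_nonneg _)) 2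
    refine (Finset.sum_le_sum hle).trans ?_
    have hP := hasSum_integral_twistedAxisAvg_sq hvc i
    have heq : ∫ x : UnitAddTorus d, ‖v x‖ ^ 2 = ∫ x : UnitAddTorus d, ρ (x j) ^ 2 * ‖θ₁ x‖ ^ 2 :=
      integral_congr_ae (Eventually.of_forall fun x => by
        simp only [hv, norm_mul, Complex.norm_real, Real.norm_eq_abs, mul_pow, sq_abs])
    rw [← heq]
    exact sum_le_hasSum F (fun n _ => integral_nonneg fun x => sq_nonneg _) hP
  -- Step 5: assemble
  have hsA := Real.sqrt_le_sqrt hA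
  have hsB := Real.sqrt_le_sqrt hB
  refine hMink.trans (pow_le_pow_left₀ (add_nonneg (Real.sqrt_nonneg _) (Real.sqrt_nonneg _)) (add_le_add hsA hsB) 2)

/-- **Square-root form of the window lemma**: `√(Σ_{k∈W}‖𝓕((θ₁+θ₂)∘Φ)(k)‖²) ≤ √(∫ρ(x_j)²‖θ₁‖²) + √(∫‖θ₂‖²)`.
[cite: Grafakos2014, Prop. 3.1.2 (5) and Prop. 3.2.7 (3)] -/
theorem sqrt_sum_window_sq_norm_comp_shearMap_le {θ₁ θ₂ : UnitAddTorus d → ℂ} (hθ₁ : Continuous θ₁)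
    (hθ₁s : Summable fun k => ‖mFourierCoeff θ₁ k‖) (hθ₂ : Continuous θ₂) {i j : d} (hij : i ≠ j) (P : ShearProfile)
    (W : Finset (d → ℤ)) (gmid grest : ℤ → UnitAddCircle → ℂ) (hgmid : ∀ n, Continuous (gmid n))
    (hgrest : ∀ n, Continuous (grest n)) (hsplit : ∀ k ∈ W, ∀ b, twist P (k i) b = gmid (k i) b + grest (k i) b)
    (hsep : ∀ k ∈ W, ∀ m : ℤ, fourierCoeff (grest (k i)) m * mFourierCoeff θ₁ (k - Pi.single j m) = 0)
    {ρ : UnitAddCircle → ℝ} (hρ : Continuous ρ) (hρ0 : ∀ b, 0 ≤ ρ b) (hbd : ∀ k ∈ W, ∀ b, ‖gmid (k i) b‖ ≤ ρ b) :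
    Real.sqrt (∑ k ∈ W, ‖mFourierCoeff ((fun x => θ₁ x + θ₂ x) ∘ shearMap i j P) k‖ ^ 2) ≤
      Real.sqrt (∫ x : UnitAddTorus d, ρ (x j) ^ 2 * ‖θ₁ x‖ ^ 2) + Real.sqrt (∫ x : UnitAddTorus d, ‖θ₂ x‖ ^ 2) := by
  have h := sum_window_sq_norm_comp_shearMap_le hθ₁ hθ₁s hθ₂ hij P W gmid grest hgmid hgrest hsplit hsep hρ hρ0 hbd
  have h0 : 0 ≤ Real.sqrt (∫ x : UnitAddTorus d, ρ (x j) ^ 2 * ‖θ₁ x‖ ^ 2) +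
      Real.sqrt (∫ x : UnitAddTorus d, ‖θ₂ x‖ ^ 2) := add_nonneg (Real.sqrt_nonneg _) (Real.sqrt_nonneg _)
  calc Real.sqrt (∑ k ∈ W, ‖mFourierCoeff ((fun x => θ₁ x + θ₂ x) ∘ shearMap i j P) k‖ ^ 2)
      ≤ Real.sqrt ((Real.sqrt (∫ x : UnitAddTorus d, ρ (x j) ^ 2 * ‖θ₁ x‖ ^ 2) +
          Real.sqrt (∫ x : UnitAddTorus d, ‖θ₂ x‖ ^ 2)) ^ 2) := Real.sqrt_le_sqrt h
    _ = _ := Real.sqrt_sq h0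

end Summit.AnomalousDissipation.AnomalousDissipation.Theorems.SawtoothPulseCascade.K1Window
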